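import Mathlib

/-!
# DEQ-A206 receipt — the zero-sum-games 'window' arithmetic (OURS; DEQ-A206 §4.3)

HONEST FRAMING: instance-level adjudication of specific advantage claims; no claim about
BQP vs BPP or the summit.

Context (informal, not formalised): at Õ-level in the QROM-query model, quantum mirror descent
solves an `m × n` zero-sum game to additive `ε` at cost `m·√n/ε²` (Augustino et al.,
arXiv:2503.17356v2, Cor. D.1).  DEQ-A206 §4.3 observes that if this is to be at most the
high-precision classical interior-point cost (leading term `m·n`, van den Brand et al. 2021 as
tabulated in arXiv:2301.03763) AND at most the prior quantum cost `√n/ε^{5/2}`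
(arXiv:2301.03763), then necessarily `m⁸ ≤ n`: the 'faster than any existing approach' window
forces very wide games.  Below is exactly that implication as real arithmetic, with
`ε^{5/2}` written as `ε² · √ε`.  Nothing about algorithms or complexity classes is formalised.
-/

namespace Summit.QuantumAdvantage.Dequantization.ZeroSumWindow

/-- Beating the prior quantum bound: `m·√n/ε² ≤ √n/(ε²·√ε)` gives `m·√ε ≤ 1`. -/
theorem m_mul_sqrt_eps_le_one (m n ε : ℝ) (hn : 0 < n) (hε : 0 < ε)
    (h : m * Real.sqrt n / ε ^ 2 ≤ Real.sqrt n / (ε ^ 2 * Real.sqrt ε)) :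
    m * Real.sqrt ε ≤ 1 := by
  have hs : 0 < Real.sqrt n := Real.sqrt_pos.mpr hn
  have hr : 0 < Real.sqrt ε := Real.sqrt_pos.mpr hε
  have hε2 : 0 < ε ^ 2 := by positivity
  have h' : m * Real.sqrt n / ε ^ 2 * (ε ^ 2 * Real.sqrt ε)
      ≤ Real.sqrt n / (ε ^ 2 * Real.sqrt ε) * (ε ^ 2 * Real.sqrt ε) :=
    mul_le_mul_of_nonneg_right h (by positivity)
  have lhs : m * Real.sqrt n / ε ^ 2 * (ε ^ 2 * Real.sqrt ε)
      = (m * Real.sqrt ε) * Real.sqrt n := by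
    field_simp
  have rhs : Real.sqrt n / (ε ^ 2 * Real.sqrt ε) * (ε ^ 2 * Real.sqrt ε) = Real.sqrt n := by
    field_simp
  rw [lhs, rhs] at h'
  -- (m·√ε)·√n ≤ √n = 1·√n
  have : (m * Real.sqrt ε) * Real.sqrt n ≤ 1 * Real.sqrt n := by simpa using h'
  exact le_of_mul_le_mul_right this hs

/-- Beating the interior-point leading term: `m·√n/ε² ≤ m·n` with `m > 0` gives `1 ≤ √n·ε²`. -/
theorem one_le_sqrt_mul_eps_sq (m n ε : ℝ) (hm : 0 < m) (hn : 0 < n) (hε : 0 < ε)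
    (h : m * Real.sqrt n / ε ^ 2 ≤ m * n) : 1 ≤ Real.sqrt n * ε ^ 2 := by
  have hs : 0 < Real.sqrt n := Real.sqrt_pos.mpr hn
  have hε2 : 0 < ε ^ 2 := by positivity
  have h1 : m * Real.sqrt n ≤ m * n * ε ^ 2 := (div_le_iff₀ hε2).mp h
  have h1' : m * Real.sqrt n ≤ m * (n * ε ^ 2) := by simpa [mul_assoc] using h1
  have h2 : Real.sqrt n ≤ n * ε ^ 2 := le_of_mul_le_mul_left h1' hm
  have hnn : n = Real.sqrt n * Real.sqrt n := (Real.mul_self_sqrt hn.le).symm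
  rw [hnn, mul_assoc] at h2
  -- √n ≤ √n · (√n · ε²)
  have : Real.sqrt n * 1 ≤ Real.sqrt n * (Real.sqrt n * ε ^ 2) := by simpa using h2
  exact le_of_mul_le_mul_left this hs

/-- **The window forces wide games.** If quantum mirror descent's `m·√n/ε²` is at most both the
classical interior-point leading term `m·n` and the prior quantum bound `√n/(ε²·√ε)`, then
`m⁸ ≤ n` (for `m, n, ε > 0`). -/
theorem m_pow_eight_le_n (m n ε : ℝ) (hm : 0 < m) (hn : 0 < n) (hε : 0 < ε)
    (hIPM : m * Real.sqrt n / ε ^ 2 ≤ m * n)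
    (hQ : m * Real.sqrt n / ε ^ 2 ≤ Real.sqrt n / (ε ^ 2 * Real.sqrt ε)) :
    m ^ 8 ≤ n := by
  have hs : 0 < Real.sqrt n := Real.sqrt_pos.mpr hn
  have hr : 0 < Real.sqrt ε := Real.sqrt_pos.mpr hε
  have a : m * Real.sqrt ε ≤ 1 := m_mul_sqrt_eps_le_one m n ε hn hε hQ
  have b : 1 ≤ Real.sqrt n * ε ^ 2 := one_le_sqrt_mul_eps_sq m n ε hm hn hε hIPM
  -- m²·ε ≤ 1
  have a2 : m ^ 2 * ε ≤ 1 := by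
    have hmr : 0 ≤ m * Real.sqrt ε := by positivity
    have := mul_le_mul a a hmr (by norm_num : (0:ℝ) ≤ 1)
    have e : m * Real.sqrt ε * (m * Real.sqrt ε) = m ^ 2 * (Real.sqrt ε * Real.sqrt ε) := by ring
    rw [Real.mul_self_sqrt hε.le] at e
    simpa [e] using this
  -- m⁸·ε⁴ ≤ 1
  have a8 : m ^ 8 * ε ^ 4 ≤ 1 := by
    have h0 : 0 ≤ m ^ 2 * ε := by positivity
    have := pow_le_one₀ h0 a2 (n := 4)
    have e : (m ^ 2 * ε) ^ 4 = m ^ 8 * ε ^ 4 := by ring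
    simpa [e] using this
  -- 1 ≤ n·ε⁴ from b squared
  have b2 : 1 ≤ n * ε ^ 4 := by
    have := mul_le_mul b b (by norm_num) (by positivity)
    have e : Real.sqrt n * ε ^ 2 * (Real.sqrt n * ε ^ 2) = (Real.sqrt n * Real.sqrt n) * ε ^ 4 := by ring
    rw [Real.mul_self_sqrt hn.le] at e
    simpa [e] using this
  -- combine: m⁸ ε⁴ ≤ 1 ≤ n ε⁴, divide by ε⁴ > 0
  have hε4 : 0 < ε ^ 4 := by positivity
  have : m ^ 8 * ε ^ 4 ≤ n * ε ^ 4 := a8.trans b2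
  exact le_of_mul_le_mul_right this hε4

/-- Numerical sanity instance of the hypotheses' shape: with `m = 1`, `n = 1`, `ε = 1`
both hypotheses hold with equality and the conclusion reads `1 ≤ 1`. -/
example : (1:ℝ) ^ 8 ≤ 1 := by norm_num

end Summit.QuantumAdvantage.Dequantization.ZeroSumWindow
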